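import Mathlib

/-!
# The `0 / 1 / all` law for lines in a plane over a finite field

Solo-informed programme (Langlands / W4 Eisenstein corner), session 24, §7.11 (16.11)(g)(★7) and (c):
the Kummer lines `η ∈ ℙ(U/p)` (a projective LINE, `dim U/p = 2`) at which a class of given degree exists
form the set of lines inside a linear subspace `W ≤ U/p` (the common kernel of finitely many linear
obstruction forms — the package locus `ker Λ_F`, the three unit forms at `p = 7`).  Such a set has
`0`, `1` or `p + 1` elements: the all-or-nothing law and the `0 / 1 / 8` law are this count.
-/

open scoped LinearAlgebra.Projectivization

namespace Summit.Langlands.Langlands.Theorems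

/-- Lines of a plane over a finite field that lie in a subspace `W`: none, one, or all `q + 1`. -/
theorem soloInformed_lines_zero_one_all
    {k V : Type*} [Field k] [Finite k] [AddCommGroup V] [Module k V]
    (hV : Module.finrank k V = 2) (W : Submodule k V) :
    Nat.card (ℙ k W) = 0 ∨ Nat.card (ℙ k W) = 1 ∨ Nat.card (ℙ k W) = Nat.card k + 1 := by
  haveI : Module.Finite k V := Module.finite_of_finrank_eq_succ hV
  have hle : Module.finrank k W ≤ 2 := hV ▸ Submodule.finrank_le W
  have key := Projectivization.card_of_finrank k W (rfl : Module.finrank k W = Module.finrank k W)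
  rcases (show Module.finrank k W = 0 ∨ Module.finrank k W = 1 ∨ Module.finrank k W = 2 by omega)
    with h0 | h1 | h2
  · left; rw [key, h0]; simp
  · right; left; rw [key, h1]; simp
  · right; right; rw [key, h2]; simp [Finset.sum_range_succ, Nat.add_comm]

/-- The whole plane has `q + 1` lines (for comparison: "all"). -/
theorem soloInformed_lines_of_plane
    {k V : Type*} [Field k] [Finite k] [AddCommGroup V] [Module k V]
    (hV : Module.finrank k V = 2) : Nat.card (ℙ k V) = Nat.card k + 1 :=
  Projectivization.card_of_finrank_two k V hV

/-- Common zeros of a family of linear forms on a plane: the lines they all kill number `0`, `1` or `q + 1`. -/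
theorem soloInformed_common_zero_lines
    {k V : Type*} [Field k] [Finite k] [AddCommGroup V] [Module k V]
    (hV : Module.finrank k V = 2) {ι : Type*} (f : ι → V →ₗ[k] k) :
    Nat.card (ℙ k (⨅ i, LinearMap.ker (f i) : Submodule k V)) = 0 ∨
    Nat.card (ℙ k (⨅ i, LinearMap.ker (f i) : Submodule k V)) = 1 ∨
    Nat.card (ℙ k (⨅ i, LinearMap.ker (f i) : Submodule k V)) = Nat.card k + 1 :=
  soloInformed_lines_zero_one_all hV _

end Summit.Langlands.Langlands.Theorems
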